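import Mathlib
import Summits.Ventures.PercRepro2.Defs
import Summits.Ventures.PercRepro2.Graph
import Summits.Ventures.PercRepro2.OneColourSwitch
import Summits.Ventures.PercRepro2.RegionHubSign
import Summits.Ventures.PercRepro2.SideSwitch
import Summits.Ventures.PercRepro2.SideSwitchFibre
import Summits.Ventures.PercRepro2.SideSwitchMono
import Summits.Ventures.PercRepro2.SideSwitchM9
import Summits.Ventures.PercRepro2.SideSwitchClosed
import Summits.Ventures.PercRepro2.SideSwitchComps
import Summits.Ventures.PercRepro2.SideSwitchCompsFibre
import Summits.Ventures.PercRepro2.M9LatticeHarrisGen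
import Summits.Ventures.PercRepro2.M9LatticeHarrisSub
import Summits.Ventures.PercRepro2.M9NoPocketDefs
import Summits.Ventures.PercRepro2.M9NoPocketWorld
import Summits.Ventures.PercRepro2.M9NoPocketWorldD
import Summits.Ventures.PercRepro2.M9NoPocketLegal
import Summits.Ventures.PercRepro2.M9NoPocketCompl

/-!
# The single-`d` class without a pocket — the lattice of legal vectors and the Harris step
(blind cell PercRepro2, p3 g20, 2026-08-27; `proofs/P3-CPNC.md` §17c (iv), (vii))

The legal vectors form a sublattice of `Finset (Finset V) × Finset E` closed under the dual
`cdual` (`L4_sup_mem`, `L4_inf_mem`, `cdual_mem_L4`; the dual is an involution on the box and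
antitone), and Harris on a self-dual sublattice holds when the involution is only an involution
on the sublattice and the functions are only monotone / antitone there
(`sum_sub_dual_mul_nonpos_of_sublattice''`, the local form of `M9LatticeHarrisGen`, through the
projection of `M9LatticeHarrisSub`).  The theorem is `M9NoPocketM9`.  Own work; std axioms.
-/

namespace Summit.Ventures.PercRepro2

namespace NoPocket

open Finset Classical RegionHub OneColourSwitch SideSwitch M9Reduce

variable {V : Type*} {E : Type*}

section HarrisLocal

variable {α : Type*} [Fintype α] [DecidableEq α] [DistribLattice α]

/-- **Harris on a self-dual sublattice, local form**: the involution `c` need only be an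
involution on `L`, and `G`, `H` need only be monotone / antitone on `L`. -/
theorem sum_sub_dual_mul_nonpos_of_sublattice'' {L : Finset α} {c : α → α}
    (hc : ∀ S ∈ L, c (c S) = S) (hcanti : Antitone c)
    (hsup : ∀ ⦃S T⦄, S ∈ L → T ∈ L → S ⊔ T ∈ L) (hinf : ∀ ⦃S T⦄, S ∈ L → T ∈ L → S ⊓ T ∈ L)
    (hL : ∀ ⦃S⦄, S ∈ L → c S ∈ L) {G H : α → ℤ}
    (hG : ∀ S ∈ L, ∀ T ∈ L, S ≤ T → G S ≤ G T) (hH : ∀ S ∈ L, ∀ T ∈ L, S ≤ T → H T ≤ H S) :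
    ∑ S ∈ L, (G S - G (c S)) * H S ≤ 0 := by
  rcases L.eq_empty_or_nonempty with rfl | hne
  · simp
  let G' : α → ℤ := fun x => G (projL L hne x)
  let H' : α → ℤ := fun x => H (projL L hne x)
  have hG' : Monotone G' := fun x x' hxx' =>
    hG _ (projL_mem hsup hinf hne x) _ (projL_mem hsup hinf hne x') (projL_mono hsup hne hxx')
  have hH' : Antitone H' := fun x x' hxx' =>
    hH _ (projL_mem hsup hinf hne x) _ (projL_mem hsup hinf hne x') (projL_mono hsup hne hxx')
  -- the zero-sum identity on `L` only needs the involution on `L`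
  have hzero : ∑ S ∈ L, (G' S - G' (c S)) = 0 := by
    rw [Finset.sum_sub_distrib]
    have : ∑ S ∈ L, G' (c S) = ∑ S ∈ L, G' S := by
      refine Finset.sum_nbij' c c (fun S hS => hL hS) (fun S hS => hL hS)
        (fun S hS => hc S hS) (fun S hS => hc S hS) (fun S _ => rfl)
    rw [this, sub_self]
  -- Mathlib's FKG for the indicator measure of `L`, as in `M9LatticeHarrisGen`
  let μ : α → ℤ := fun S => if S ∈ L then 1 else 0
  let k : ℤ := ∑ S, |G' S|
  let k' : ℤ := ∑ S, |H' S|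
  let F : α → ℤ := fun S => G' S - G' (c S) + 2 * k
  let K : α → ℤ := fun S => k' - H' S
  have habsG : ∀ S, |G' S| ≤ k := fun S =>
    Finset.single_le_sum (f := fun S => |G' S|) (fun S _ => abs_nonneg _) (Finset.mem_univ S)
  have habsH : ∀ S, |H' S| ≤ k' := fun S =>
    Finset.single_le_sum (f := fun S => |H' S|) (fun S _ => abs_nonneg _) (Finset.mem_univ S)
  have hF₀ : 0 ≤ F := by
    intro S
    have h1 := habsG S; have h2 := habsG (c S)
    have := abs_le.1 h1; have := abs_le.1 h2
    simp only [F, Pi.zero_apply]; linarith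
  have hK₀ : 0 ≤ K := by
    intro S
    have := abs_le.1 (habsH S)
    simp only [K, Pi.zero_apply]; linarith
  have hμ₀ : 0 ≤ μ := fun S => by simp only [μ, Pi.zero_apply]; split_ifs <;> norm_num
  have hFmono : Monotone F := by
    intro S T hST
    simp only [F]
    have h1 := hG' hST
    have h2 := hG' (hcanti hST)
    linarith
  have hKmono : Monotone K := by
    intro S T hST
    simp only [K]
    have := hH' hST
    linarith
  have hμ : ∀ a b, μ a * μ b ≤ μ (a ⊓ b) * μ (a ⊔ b) := by
    intro a b
    simp only [μ]
    by_cases ha : a ∈ L <;> by_cases hb : b ∈ L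
    · have h1 : a ⊓ b ∈ L := hinf ha hb
      have h2 : a ⊔ b ∈ L := hsup ha hb
      rw [if_pos ha, if_pos hb, if_pos h1, if_pos h2]
    · rw [if_pos ha, if_neg hb]; simp only [mul_zero]; split_ifs <;> norm_num
    · rw [if_neg ha]; simp only [zero_mul]; split_ifs <;> norm_num
    · rw [if_neg ha]; simp only [zero_mul]; split_ifs <;> norm_num
  have key := fkg F K μ hμ₀ hF₀ hK₀ hFmono hKmono hμ
  have hsum : ∀ f : α → ℤ, ∑ S, μ S * f S = ∑ S ∈ L, f S := by
    intro f
    simp only [μ, ite_mul, one_mul, zero_mul]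
    rw [Finset.sum_ite_mem, Finset.univ_inter]
  have hsum1 : ∑ S, μ S = (L.card : ℤ) := by
    have := hsum (fun _ => 1)
    simp only [mul_one] at this
    rw [this]; simp
  rw [hsum, hsum, hsum1, hsum] at key
  have eF : ∑ S ∈ L, F S = 2 * k * L.card := by
    simp only [F]
    rw [Finset.sum_add_distrib, hzero, zero_add, Finset.sum_const, nsmul_eq_mul]; ring
  have eK : ∑ S ∈ L, K S = k' * L.card - ∑ S ∈ L, H' S := by
    simp only [K]
    rw [Finset.sum_sub_distrib, Finset.sum_const, nsmul_eq_mul]; ring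
  have eFK : ∑ S ∈ L, F S * K S =
      -(∑ S ∈ L, (G' S - G' (c S)) * H' S) + 2 * k * (k' * L.card - ∑ S ∈ L, H' S) := by
    simp only [F, K]
    have : ∀ S, (G' S - G' (c S) + 2 * k) * (k' - H' S) =
        -((G' S - G' (c S)) * H' S) + k' * (G' S - G' (c S)) + 2 * k * (k' - H' S) :=
      fun S => by ring
    simp_rw [this]
    rw [Finset.sum_add_distrib, Finset.sum_add_distrib, Finset.sum_neg_distrib,
      ← Finset.mul_sum, hzero, mul_zero, add_zero, ← Finset.mul_sum, Finset.sum_sub_distrib,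
      Finset.sum_const, nsmul_eq_mul]
    ring
  rw [eF, eK, eFK] at key
  have hposZ : (0 : ℤ) < L.card := by exact_mod_cast hne.card_pos
  have hX : (L.card : ℤ) * ∑ S ∈ L, (G' S - G' (c S)) * H' S ≤ 0 := by linarith
  have hmain := nonpos_of_mul_nonpos_right hX hposZ
  refine le_trans (le_of_eq ?_) hmain
  refine Finset.sum_congr rfl (fun S hS => ?_)
  simp only [G', H']
  rw [projL_of_mem hne hS, projL_of_mem hne (hL hS)]

end HarrisLocal

section Lattice

variable [Fintype V] [DecidableEq V] [Fintype E] [DecidableEq E]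

variable {ends : E → Sym2 V}

omit [Fintype V] [Fintype E] in
/-- The components of a sup of vectors. -/
lemma sup_fst_snd (x x' : Finset (Finset V) × Finset E) :
    (x ⊔ x').1 = x.1 ∪ x'.1 ∧ (x ⊔ x').2 = x.2 ∪ x'.2 := ⟨rfl, rfl⟩

omit [Fintype V] [Fintype E] in
/-- The components of an inf of vectors. -/
lemma inf_fst_snd (x x' : Finset (Finset V) × Finset E) :
    (x ⊓ x').1 = x.1 ∩ x'.1 ∧ (x ⊓ x').2 = x.2 ∩ x'.2 := ⟨rfl, rfl⟩

/-- The legal vectors are closed under `⊔`. -/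
lemma L4_sup_mem {d r s : V} {ρ : Config E} {x x' : Finset (Finset V) × Finset E}
    (hx : x ∈ L4 ends d r s ρ) (hx' : x' ∈ L4 ends d r s ρ) : x ⊔ x' ∈ L4 ends d r s ρ := by
  obtain ⟨⟨hT, hF⟩, hW, hY⟩ := mem_L4.1 hx
  obtain ⟨⟨hT', hF'⟩, hW', hY'⟩ := mem_L4.1 hx'
  obtain ⟨e1, e2⟩ := sup_fst_snd x x'
  rw [mem_L4, e1, e2]
  refine ⟨⟨Finset.union_subset hT hT', Finset.union_subset hF hF'⟩, ?_, ?_⟩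
  · intro hsrc C hC hCx
    have hsrc' : srcW ends d r s ρ x ∨ srcW ends d r s ρ x' := by
      rcases hsrc with ⟨e, he, heT⟩ | ⟨C', hC', hY'⟩
      · rcases Finset.mem_union.1 he with h | h
        · exact Or.inl (Or.inl ⟨e, h, heT⟩)
        · exact Or.inr (Or.inl ⟨e, h, heT⟩)
      · rcases Finset.mem_union.1 hC' with h | h
        · exact Or.inl (Or.inr ⟨C', h, hY'⟩)
        · exact Or.inr (Or.inr ⟨C', h, hY'⟩)
    rcases hsrc' with h | h
    · exact hW h C hC (fun h' => hCx (Finset.mem_union_left _ h'))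
    · exact hW' h C hC (fun h' => hCx (Finset.mem_union_right _ h'))
  · intro hsrc C hCx
    have hsrc' : srcY ends d r s ρ x ∧ srcY ends d r s ρ x' := by
      rcases hsrc with ⟨e, heT, he⟩ | ⟨C', hC', hC'x, hY'⟩
      · exact ⟨Or.inl ⟨e, heT, fun h => he (Finset.mem_union_left _ h)⟩,
          Or.inl ⟨e, heT, fun h => he (Finset.mem_union_right _ h)⟩⟩
      · exact ⟨Or.inr ⟨C', hC', fun h => hC'x (Finset.mem_union_left _ h), hY'⟩,
          Or.inr ⟨C', hC', fun h => hC'x (Finset.mem_union_right _ h), hY'⟩⟩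
    rcases Finset.mem_union.1 hCx with h | h
    · exact hY hsrc'.1 C h
    · exact hY' hsrc'.2 C h

/-- The legal vectors are closed under `⊓`. -/
lemma L4_inf_mem {d r s : V} {ρ : Config E} {x x' : Finset (Finset V) × Finset E}
    (hx : x ∈ L4 ends d r s ρ) (hx' : x' ∈ L4 ends d r s ρ) : x ⊓ x' ∈ L4 ends d r s ρ := by
  obtain ⟨⟨hT, hF⟩, hW, hY⟩ := mem_L4.1 hx
  obtain ⟨⟨hT', hF'⟩, hW', hY'⟩ := mem_L4.1 hx'
  obtain ⟨e1, e2⟩ := inf_fst_snd x x'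
  rw [mem_L4, e1, e2]
  refine ⟨⟨Finset.inter_subset_left.trans hT, Finset.inter_subset_left.trans hF⟩, ?_, ?_⟩
  · intro hsrc C hC hCx
    have hsrc' : srcW ends d r s ρ x ∧ srcW ends d r s ρ x' := by
      rcases hsrc with ⟨e, he, heT⟩ | ⟨C', hC', hY''⟩
      · obtain ⟨h1, h2⟩ := Finset.mem_inter.1 he
        exact ⟨Or.inl ⟨e, h1, heT⟩, Or.inl ⟨e, h2, heT⟩⟩
      · obtain ⟨h1, h2⟩ := Finset.mem_inter.1 hC'
        exact ⟨Or.inr ⟨C', h1, hY''⟩, Or.inr ⟨C', h2, hY''⟩⟩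
    by_cases h : C ∈ x.1
    · have h' : C ∉ x'.1 := fun h' => hCx (Finset.mem_inter.2 ⟨h, h'⟩)
      exact hW' hsrc'.2 C hC h'
    · exact hW hsrc'.1 C hC h
  · intro hsrc C hCx
    obtain ⟨h1, h2⟩ := Finset.mem_inter.1 hCx
    have hsrc' : srcY ends d r s ρ x ∨ srcY ends d r s ρ x' := by
      rcases hsrc with ⟨e, heT, he⟩ | ⟨C', hC', hC'x, hY''⟩
      · by_cases h : e ∈ x.2
        · exact Or.inr (Or.inl ⟨e, heT, fun h' => he (Finset.mem_inter.2 ⟨h, h'⟩)⟩)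
        · exact Or.inl (Or.inl ⟨e, heT, h⟩)
      · by_cases h : C' ∈ x.1
        · exact Or.inr (Or.inr ⟨C', hC', fun h' => hC'x (Finset.mem_inter.2 ⟨h, h'⟩), hY''⟩)
        · exact Or.inl (Or.inr ⟨C', hC', h, hY''⟩)
    rcases hsrc' with h | h
    · exact hY h C h1
    · exact hY' h C h2

/-- The dual vector of a legal vector is legal. -/
lemma cdual_mem_L4 {d r s : V} {ρ : Config E} {x : Finset (Finset V) × Finset E}
    (hx : x ∈ L4 ends d r s ρ) : cdual ends d r s ρ x ∈ L4 ends d r s ρ := by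
  obtain ⟨⟨hT, hF⟩, hW, hY⟩ := mem_L4.1 hx
  rw [mem_L4]
  refine ⟨⟨Finset.sdiff_subset, Finset.sdiff_subset⟩, ?_, ?_⟩
  · -- a `W`-source of the dual is a `Y`-source of `x`
    intro hsrc C hC hCx
    have hsrc' : srcY ends d r s ρ x := by
      rcases hsrc with ⟨e, he, heT⟩ | ⟨C', hC', hY'⟩
      · exact Or.inl ⟨e, heT, (Finset.mem_sdiff.1 he).2⟩
      · obtain ⟨h1, h2⟩ := Finset.mem_sdiff.1 hC'
        exact Or.inr ⟨C', h1, h2, hY'⟩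
    have hCx' : C ∈ x.1 := by
      by_contra h
      exact hCx (Finset.mem_sdiff.2 ⟨hC, h⟩)
    exact hY hsrc' C hCx'
  · -- a `Y`-source of the dual is a `W`-source of `x`
    intro hsrc C hCx
    obtain ⟨hC, hCx'⟩ := Finset.mem_sdiff.1 hCx
    have hsrc' : srcW ends d r s ρ x := by
      rcases hsrc with ⟨e, heT, he⟩ | ⟨C', hC', hC'x, hY'⟩
      · by_contra h
        exact he (Finset.mem_sdiff.2 ⟨heT, fun h' => h (Or.inl ⟨e, h', heT⟩)⟩)
      · by_contra h
        exact hC'x (Finset.mem_sdiff.2 ⟨hC', fun h' => h (Or.inr ⟨C', h', hY'⟩)⟩)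
    exact hW hsrc' C hC hCx'

/-- The dual is an involution on the vectors inside the ground pair. -/
lemma cdual_cdual {d r s : V} {ρ : Config E} {x : Finset (Finset V) × Finset E}
    (hT : x.1 ⊆ blocks ends d r s ρ) (hF : x.2 ⊆ Tset ends d r s) :
    cdual ends d r s ρ (cdual ends d r s ρ x) = x := by
  simp only [cdual]
  rw [Finset.sdiff_sdiff_eq_self hT, Finset.sdiff_sdiff_eq_self hF]

/-- The dual is antitone. -/
lemma cdual_antitone {d r s : V} (ρ : Config E) : Antitone (cdual ends d r s ρ) := by
  intro x x' hxx'
  obtain ⟨h1, h2⟩ := Prod.le_def.1 hxx'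
  refine Prod.le_def.2 ⟨?_, ?_⟩
  · exact Finset.sdiff_subset_sdiff (Finset.Subset.refl _) h1
  · exact Finset.sdiff_subset_sdiff (Finset.Subset.refl _) h2

/-- The dual with respect to the outside-flipped representative is the dual. -/
lemma cdual_flipOp {d r s : V} (hr : d ≠ r) (hs : d ≠ s) (ρ : Config E)
    (x : Finset (Finset V) × Finset E) :
    cdual ends d r s (flipOp ends d r s ρ) x = cdual ends d r s ρ x := by
  simp only [cdual, blocks_flipOp hr hs]

end Lattice

end NoPocket

end Summit.Ventures.PercRepro2
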